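import Summits.KontsevichZagierPeriods.KontsevichZagierPeriods.Theorems.FurushoPentagonDoubleShuffleInKZReduction
import Literature.NumberTheory.Transcendental.MultipleZetaStar

/-!
# `DoubleShuffleInKZ` (stmt-KontsevichZagierPeriods-14665, route `FurushoPentagon`): the shuffle side
# `⟨ψ, reg_ш(yⁱ x v)⟩ = (-1)ⁱ Σ_{w ∈ yⁱ ш v} ψ(x w)` of the integral–series reduction

Helper file (`--supports stmt-KontsevichZagierPeriods-14665`), second of three (harmonic algebra:
`FurushoPentagonDoubleShuffleInKZIntegralSeriesAlgebra.lean`; the reduction itself: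
`FurushoPentagonDoubleShuffleInKZIntegralSeries.lean`).  Word combinatorics of IKZ's explicit
regularisation formula [IharaKanekoZagier2006, Cor. 5]: `reg_ш(yⁱ x v) = Σ_{k ≤ i} (-1)ᵏ yᵏ ш (y^{i-k} x v)`
(the tree's `MZV.shuffleReg` / `MZV.regFront`), paired with a function `ψ` that kills the words beginning
with `y` — as the realisation `ψ(v) = χ(Z(index of v))` (convergent `v`), `0` (otherwise) of the route
item does: only the term `k = i` survives and contributes the words `x (yⁱ ш v)`, so
`⟨ψ, reg_ш(yⁱ x v)⟩ = (-1)ⁱ Σ_{w ∈ yⁱ ш v} ψ(x w)` (`pair_shuffleReg_replicate_true_append`), and for the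
word of an index `(1ⁱ, b+1, t')`, `b ≥ 1`, every `x w` is convergent (`pair_shuffleReg_binaryWord`).
The right-hand side `Σ_{w ∈ yⁱ ш v} Z(x w)` is the LEFT side of the Kaneko–Yamamoto integral–series
identity with `l = (1^{i+1})` [KanekoYamamoto2018, Thm 4.1]: the `V`-shaped 2-poset integral dissected
into its linear extensions.  Also the two sides at `i = 0` (`shuffleSide_zero`, `starSide_zero`).

References: K. Ihara, M. Kaneko, D. Zagier, Compos. Math. 142 (2006), Cor. 5 p. 322; M. Kaneko,
S. Yamamoto, Selecta Math. 24 (2018), §2, Thm 4.1.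
-/

noncomputable section

open scoped BigOperators

namespace Summit.KontsevichZagierPeriods.FurushoPentagon.DoubleShuffleInKZ.IntegralSeries

open Literature.NumberTheory.Transcendental
open Literature.NumberTheory.Transcendental.MZV (starIndices sumStuffle)

/-! ### The shuffle side: `⟨ψ, reg_ш(yⁱ x v)⟩ = (-1)ⁱ Σ_{w ∈ yⁱ ш v} ψ(x w)` -/

/-- Interleavings of two words that end with `y` (or are empty) end with `y`, and are non-empty
as soon as the second word is. [folklore] -/
theorem getLast_of_mem_shuffleWord : ∀ (u v : List Bool), (u = [] ∨ u.getLast? = some true) →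
    (v = [] ∨ v.getLast? = some true) → ∀ w ∈ MZV.shuffleWord u v, (w = [] ∨ w.getLast? = some true)
  | [], v, _, hv, w, hw => by simp at hw; subst hw; exact hv
  | a :: u, [], hu, _, w, hw => by simp at hw; subst hw; exact hu
  | a :: u, b :: v, hu, hv, w, hw => by
    rw [MZV.shuffleWord_cons_cons, List.mem_append, List.mem_map, List.mem_map] at hw
    have hu' : u = [] ∨ u.getLast? = some true := by
      rcases u with _ | ⟨c, u⟩
      · exact Or.inl rfl
      · rcases hu with h | h
        · simp at h
        · exact Or.inr (by simpa [List.getLast?_cons_cons] using h)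
    have hv' : v = [] ∨ v.getLast? = some true := by
      rcases v with _ | ⟨c, v⟩
      · exact Or.inl rfl
      · rcases hv with h | h
        · simp at h
        · exact Or.inr (by simpa [List.getLast?_cons_cons] using h)
    rcases hw with ⟨w', hw', rfl⟩ | ⟨w', hw', rfl⟩
    · have h := getLast_of_mem_shuffleWord u (b :: v) hu' hv w' hw'
      have hne : w' ≠ [] := by
        intro h0
        have := MZV.length_of_mem_shuffleWord u (b :: v) hw'
        rw [h0] at this; simp at this
      rcases h with h | h
      · exact absurd h hne
      · right
        obtain ⟨c, w'', rfl⟩ := List.exists_cons_of_ne_nil hne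
        rwa [List.getLast?_cons_cons]
    · have h := getLast_of_mem_shuffleWord (a :: u) v hu hv' w' hw'
      rcases h with h | h
      · exfalso
        have hl := MZV.length_of_mem_shuffleWord (a :: u) v hw'
        rw [h] at hl
        simp at hl
        omega
      · right
        have hne : w' ≠ [] := by
          intro h0; rw [h0] at h; simp at h
        obtain ⟨c, w'', rfl⟩ := List.exists_cons_of_ne_nil hne
        rwa [List.getLast?_cons_cons]
termination_by u v => u.length + v.length

/-- `⟨ψ, yⁱ ш (y w)⟩ = 0` when `ψ` kills the words beginning with `y`. [folklore] -/
theorem pair_shuffleSum_replicate_true_true_cons {R : Type*} [AddCommMonoid R] [Module ℚ R]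
    (ψ : List Bool → R) (hψ : ∀ w, ψ (true :: w) = 0) :
    ∀ (i : ℕ) (w : List Bool), Shuffle.pair ψ (MZV.shuffleSum (List.replicate i true) (true :: w)) = 0
  | 0, w => by simp [Shuffle.pair_single, hψ]
  | i + 1, w => by
    rw [List.replicate_succ, MZV.shuffleSum_cons_cons, Shuffle.pair_add, Shuffle.pair_mapDomain,
      Shuffle.pair_mapDomain]
    have h0 : (ψ ∘ List.cons true) = fun _ => 0 := funext fun v => hψ v
    rw [h0]
    simp [Shuffle.pair]

/-- `⟨ψ, yⁱ ш (x v)⟩ = Σ_{w ∈ yⁱ ш v} ψ(x w)` when `ψ` kills the words beginning with `y`.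
[folklore] -/
theorem pair_shuffleSum_replicate_true_false_cons {R : Type*} [AddCommMonoid R] [Module ℚ R]
    (ψ : List Bool → R) (hψ : ∀ w, ψ (true :: w) = 0) :
    ∀ (i : ℕ) (v : List Bool), Shuffle.pair ψ (MZV.shuffleSum (List.replicate i true) (false :: v)) =
      ((MZV.shuffleWord (List.replicate i true) v).map fun w => ψ (false :: w)).sum
  | 0, v => by simp [Shuffle.pair_single]
  | i + 1, v => by
    rw [List.replicate_succ, MZV.shuffleSum_cons_cons, Shuffle.pair_add, Shuffle.pair_mapDomain,
      Shuffle.pair_mapDomain, ← List.replicate_succ]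
    have h0 : (ψ ∘ List.cons true) = fun _ => 0 := funext fun v => hψ v
    rw [h0]
    simp only [Shuffle.pair, Finsupp.sum, smul_zero, Finset.sum_const_zero, zero_add]
    rw [show MZV.shuffleSum (List.replicate (i + 1) true) v =
      Shuffle.wordSum (MZV.shuffleWord (List.replicate (i + 1) true) v) from rfl]
    change Shuffle.pair (ψ ∘ List.cons false) _ = _
    rw [Shuffle.pair_wordSum]
    rfl

/-- `yⁱ x v` has `i` leading `y`'s. [folklore] -/
theorem leadingY_replicate_true_append_false (i : ℕ) (v : List Bool) :
    MZV.leadingY (List.replicate i true ++ false :: v) = i := by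
  induction i with
  | zero => simp [MZV.leadingY]
  | succ i ih =>
    simp only [MZV.leadingY, List.replicate_succ, List.cons_append, List.takeWhile_cons_of_pos,
      List.length_cons] at ih ⊢
    omega

/-- **IKZ's Corollary 5 paired with a function killing `y`-headed words**: for a word `yⁱ x v`
ending in `y`, `⟨ψ, reg_ш(yⁱ x v)⟩ = (-1)ⁱ Σ_{w ∈ yⁱ ш v} ψ(x w)` — in
`reg_ш(yⁱ x v) = Σ_{k ≤ i} (-1)ᵏ yᵏ ш (y^{i-k} x v)` only the term `k = i` has words beginning with
`x`, namely `x (yⁱ ш v)`. [cite: IharaKanekoZagier2006, Cor. 5 p. 322] -/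
theorem pair_shuffleReg_replicate_true_append {R : Type*} [AddCommMonoid R] [Module ℚ R]
    (ψ : List Bool → R) (hψ : ∀ w, ψ (true :: w) = 0) (i : ℕ) {v : List Bool}
    (hv : (false :: v).getLast? = some true) :
    Shuffle.pair ψ (MZV.shuffleReg (List.replicate i true ++ false :: v)) =
      ((-1 : ℚ) ^ i) • ((MZV.shuffleWord (List.replicate i true) v).map fun w => ψ (false :: w)).sum := by
  have hlast : (List.replicate i true ++ false :: v).getLast? = some true := by
    rw [List.getLast?_append, hv]; rfl
  have h1 : MZV.regEnd (List.replicate i true ++ false :: v) =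
      Finsupp.single (List.replicate i true ++ false :: v) 1 :=
    MZV.regEnd_of_trailingX_eq_zero (MZV.trailingX_eq_zero hlast)
  rw [MZV.shuffleReg, h1, Finsupp.sum_single_index (h := fun u a => a • MZV.regFront u) (zero_smul ℚ _),
    one_smul, MZV.regFront,
    leadingY_replicate_true_append_false, Shuffle.pair_sum, Finset.sum_range_succ,
    Finset.sum_eq_zero fun k hk => ?_]
  · rw [zero_add, Shuffle.pair_smul, List.drop_append_of_le_length (by simp), List.drop_replicate,
      Nat.sub_self, List.replicate_zero, List.nil_append, pair_shuffleSum_replicate_true_false_cons ψ hψ]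
  · rw [Finset.mem_range] at hk
    rw [Shuffle.pair_smul, List.drop_append_of_le_length (by simp; omega), List.drop_replicate]
    obtain ⟨m, hm⟩ : ∃ m, i - k = m + 1 := ⟨i - k - 1, by omega⟩
    rw [hm, List.replicate_succ, List.cons_append, pair_shuffleSum_replicate_true_true_cons ψ hψ, smul_zero]

/-! ### Word bookkeeping and the two sides at `i = 0` -/

/-- `binaryWord (1ⁱ u) = yⁱ binaryWord u`. [folklore] -/
theorem binaryWord_replicate_one_append (i : ℕ) (u : List ℕ) :
    MZV.binaryWord (List.replicate i 1 ++ u) = List.replicate i true ++ MZV.binaryWord u := by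
  induction i with
  | zero => rfl
  | succ i ih =>
    rw [List.replicate_succ, List.cons_append, MZV.binaryWord, ih]
    simp [List.replicate_succ]

/-- `binaryWord ((b+2) t) = x (x^b y binaryWord t)`. [folklore] -/
theorem binaryWord_succ_succ_cons (b : ℕ) (t : List ℕ) :
    MZV.binaryWord ((b + 1 + 1) :: t) = false :: (List.replicate b false ++ true :: MZV.binaryWord t) := by
  simp [MZV.binaryWord, List.replicate_succ]

/-- `yⁿ` is empty or ends with `y`. [folklore] -/
theorem replicate_true_endsWell (n : ℕ) :
    List.replicate n true = [] ∨ (List.replicate n true).getLast? = some true := by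
  cases n with
  | zero => exact Or.inl rfl
  | succ n => exact Or.inr (by rw [List.replicate_succ']; simp)

/-- `χ` through a summed harmonic product. [folklore] -/
theorem map_sumStuffle {A B : Type*} [AddCommMonoid A] [AddCommMonoid B] {F : Type*} [FunLike F A B]
    [AddMonoidHomClass F A B] (χ : F) (f : List ℕ → A) (s t : List ℕ) :
    χ (sumStuffle f s t) = sumStuffle (fun u => χ (f u)) s t := by
  rw [MZV.sumStuffle, MZV.sumStuffle, map_list_sum, List.map_map]; rfl

/-- `(-1 : ℚ)ⁱ • x = (-1)ⁱ x` in a `ℚ`-algebra. [folklore] -/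
theorem neg_one_pow_rat_smul {R : Type*} [CommRing R] [Algebra ℚ R] (i : ℕ) (x : R) :
    ((-1 : ℚ) ^ i) • x = (-1 : R) ^ i * x := by
  rw [← algebraMap_smul R ((-1 : ℚ) ^ i) x, smul_eq_mul, map_pow, map_neg, map_one]

/-- The integral–series right-hand side at `j = 0` is the index itself:
`Σ_{c ∈ (1)⋆} Σ_{w ∈ t ∗ c.tail} f((b + c₁) w) = f((b+1) t)`. [cite: KanekoYamamoto2018, §2] -/
theorem starSide_zero {M : Type*} [AddCommMonoid M] (f : List ℕ → M) (b : ℕ) (t : List ℕ) :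
    ((starIndices (List.replicate (0 + 1) 1)).map fun c =>
      sumStuffle (fun w => f ((b + c.headD 0) :: w)) t c.tail).sum = f ((b + 1) :: t) := by
  simp only [show List.replicate (0 + 1) 1 = [1] from rfl, MZV.starIndices_singleton, List.map_cons,
    List.map_nil, List.sum_cons, List.sum_nil, add_zero, List.headD_cons, List.tail_cons,
    MZV.sumStuffle_nil_right]

/-- **The shuffle side evaluated**: with `ψ(v) = χ(Z(index of v))` on convergent words and `0`
elsewhere, for `b ≥ 1` and a positive index `t'`,
`⟨ψ, reg_ш(binaryWord(1ⁱ (b+1) t'))⟩ = (-1)ⁱ Σ_{w ∈ yⁱ ш v} χ(Z(index of x w))`, `x v = binaryWord((b+1) t')`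
(IKZ Cor. 5 + every `x w` is convergent). [cite: IharaKanekoZagier2006, Cor. 5 p. 322] -/
theorem pair_shuffleReg_binaryWord {R : Type} [CommRing R] [Algebra ℚ R] (χ : KZ.FormalRep →+ R)
    (Z : List ℕ → KZ.FormalRep) (i b : ℕ) (hb : 1 ≤ b) (t' : List ℕ) :
    Shuffle.pair (fun v => if MZV.IsConvergentWord v then χ (Z (MZV.ofBinaryWord v)) else 0)
        (MZV.shuffleReg (MZV.binaryWord (List.replicate i 1 ++ (b + 1) :: t'))) =
      (-1 : R) ^ i * ((MZV.shuffleWord (List.replicate i true) (MZV.binaryWord ((b + 1) :: t')).tail).map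
        fun w => χ (Z (MZV.ofBinaryWord (false :: w)))).sum := by
  set ψ : List Bool → R := fun v => if MZV.IsConvergentWord v then χ (Z (MZV.ofBinaryWord v)) else 0
    with hψdef
  have hψ0 : ∀ w : List Bool, ψ (true :: w) = 0 := fun w =>
    if_neg (by rintro (h | ⟨h, -⟩) <;> simp at h)
  obtain ⟨b', rfl⟩ : ∃ b', b = b' + 1 := ⟨b - 1, by omega⟩
  set v : List Bool := List.replicate b' false ++ true :: MZV.binaryWord t' with hvdef
  have hword : MZV.binaryWord ((b' + 1 + 1) :: t') = false :: v := binaryWord_succ_succ_cons b' t'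
  have hv : (false :: v).getLast? = some true := by
    rw [← hword]; exact MZV.getLast?_binaryWord (List.cons_ne_nil _ _)
  have hvw : v = [] ∨ v.getLast? = some true := by
    right
    rcases hq : v with _ | ⟨c, v'⟩
    · rw [hq] at hv; simp at hv
    · rw [hq, List.getLast?_cons_cons] at hv; exact hv
  rw [binaryWord_replicate_one_append, hword, pair_shuffleReg_replicate_true_append ψ hψ0 i hv,
    neg_one_pow_rat_smul, List.tail_cons]
  congr 1
  refine congrArg List.sum (List.map_congr_left fun w hw => ?_)
  have h1 := getLast_of_mem_shuffleWord _ _ (replicate_true_endsWell i) hvw w hw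
  have hne' : w ≠ [] := by
    intro h0
    have hl := MZV.length_of_mem_shuffleWord _ _ hw
    rw [h0] at hl
    rcases hq : v with _ | ⟨c, v'⟩
    · rw [hq] at hv; simp at hv
    · rw [hq] at hl; simp at hl
  rcases h1 with h1 | h1
  · exact absurd h1 hne'
  · refine if_pos (Or.inr ⟨rfl, ?_⟩)
    obtain ⟨c, w', rfl⟩ := List.exists_cons_of_ne_nil hne'
    rwa [List.getLast?_cons_cons]

/-- The shuffle side at `i = 0` is the index itself: `Z(index of (x v)) = Z((b+1) t)`.
[folklore] -/
theorem shuffleSide_zero {M : Type*} (f : List ℕ → M) [AddCommMonoid M] (b : ℕ) (hb : 1 ≤ b) (t : List ℕ)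
    (ht : ∀ x ∈ t, 1 ≤ x) :
    ((MZV.shuffleWord (List.replicate 0 true) (MZV.binaryWord ((b + 1) :: t)).tail).map
        fun w => f (MZV.ofBinaryWord (false :: w))).sum = f ((b + 1) :: t) := by
  obtain ⟨b', rfl⟩ : ∃ b', b = b' + 1 := ⟨b - 1, by omega⟩
  rw [binaryWord_succ_succ_cons, List.tail_cons]
  simp only [List.replicate_zero, MZV.shuffleWord_nil_left, List.map_cons, List.map_nil, List.sum_cons,
    List.sum_nil, add_zero]
  rw [← binaryWord_succ_succ_cons, MZV.ofBinaryWord_binaryWord]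
  intro x hx
  rcases List.mem_cons.mp hx with rfl | hx
  · omega
  · exact ht x hx

end Summit.KontsevichZagierPeriods.FurushoPentagon.DoubleShuffleInKZ.IntegralSeries

end
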